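import Summits.Langlands.Langlands.Theorems.IrreducibilityBySelfDualityIrreducibleOffSectorOfReciprocity
import Summits.Langlands.Langlands.Theorems.IrreducibilityBySelfDualityReciprocityUpToIrreducibilityIsobaricRigidity
import Summits.Langlands.Langlands.Theorems.IrreducibilityBySelfDualityReciprocityUpToIrreducibilityDeRhamBlocks
import Summits.Langlands.Langlands.Theorems.IrreducibilityBySelfDualityReciprocityUpToIrreducibilityGeometricConstituents
import Literature.NumberTheory.Automorphic.ChebotarevArtinRepHolds
import Literature.NumberTheory.GaloisRepresentations.FramedRepEquivConj
import Literature.NumberTheory.Automorphic.IsAutomorphicAE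
import Literature.NumberTheory.Automorphic.GLnAdelicStructureProofs
import HarnessLib

/-!
# Route MirrorPairReflection — `SectorComplement` (stmt-Langlands-12840) from its typed leaves, STRUCTURAL

Crux-strategist (unit `cstrat-stmt-Langlands-12840-r1`, RESTATED re-audit, BC2 REDIRECT), 2026-08-17.
`SectorComplement := EvenReducibleResidueClassification → _root_.Langlands` is the route's D-0027 frame item
("the rest of the summit", summit-equivalent given the target `X := EvenReducibleResidueClassification`).  This
module PROVES, sorry-free and without importing any `Theses` file (so that the gate can link it from the route
file), the assembly of the typed decomposition of `SectorComplement` into seven leaves — for the REVISED summit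
`Langlands = ∀ F, Nonempty (ReciprocityData F) ∧ ∀ 𝓡 n, 0 < n → ∀ hcpt, (A) ∧ (B)` (statement revision
p141787, 2026-08-17, `∀ 𝓡` + non-vacuity conjunct; the earlier `∃ 𝓡`-seam
`IrreducibleOffSector.langlands_of_reciprocityUpToIrreducibility_text_of_JS` no longer elaborates):

* N  `CanonicalReciprocityData` — the summit's non-vacuity conjunct VERBATIM (= item stmt-Langlands-17930): canonically
     normalised local Langlands data at every completion of every number field (Harris–Taylor Thm A / Henniart +
     local class field theory pins);
* W  `WeakExistence` — Buzzard–Gee Conj. 3.2.2, weak form: an L-algebraic cuspidal `π` has SOME `ℓ`-adic avatar,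
     unramified a.e., de Rham above `ℓ` for Fontaine's PINNED datum, Satake–Frobenius compatible a.e. (`𝓡`-free);
* B⁻ `WeakAutomorphyOffSector` — Fontaine–Mazur–Langlands, a.e. form, for irreducible pinned-geometric `ρ` OUTSIDE
     X's sector `[K:ℚ] = 1 ∧ n = 2 ∧ ℓ ≠ 2 ∧ ρ unramified outside ℓ ∧ ρ̄^ss = ω^a ⊕ ω^b, a + b even` (`𝓡`-free);
* B⁺ `SectorAutomorphyOfClassification` — `X →` weak automorphy ON the sector (the leaf that USES the route target:
     dihedral from `ℚ(√ℓ)` ⇒ automorphic induction of a Hecke character of the real quadratic field; `𝓡`-free);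
* L  `PairCompatibilityAllData` — Taylor 2004 Conj. 7 for irreducible pinned-geometric a.e.-compatible pairs at
     EVERY finite place and for EVERY reciprocity datum `𝓡` (the only leaf mentioning `𝓡`; `∀ 𝓡` in lockstep with
     the revised summit);
* JS `PairLBoundaryJS`, `PairLPoleJS` — Arthur–Clozel Ch. 3 (2.2)/(2.3) for Borel–Jacquet data (= items
     stmt-Langlands-13622 / 19093 of the route, definitionally the Literature named facts
     `JacquetShalika1981_partialPairL_boundary_repData` / `…_pole_repData`).

**Theorem** (`sectorComplement_of_leaves`).  `N → W → B⁻ → B⁺ → L → JS(2.2) → JS(2.3) → (X → Langlands)`,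
every hypothesis and the conclusion written as TEXT (the route decls unfolded; by-name certificate in the
planner folder, `GlueByName.lean`).  Proof (≈ 80 tactic lines, not a one-line seam): given `X`, weak automorphy
B_w is rebuilt from B⁻/B⁺ by a case split on the sector; the ISOBARIC BOOTSTRAP (landed
`ReciprocityUpToIrreducibility.stub_geometricConstituents` p99702 + `stub_deRhamBlocks` p98936 +
`stub_isobaricRigidity` p105601, run with B_w and JS) makes every pinned-geometric a.e.-compatible avatar of a
cuspidal `π` IRREDUCIBLE; then, for EACH reciprocity datum `𝓡`, clause (B) is B_w + L and clause (A) is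
W + bootstrap + L, with uniqueness up to conjugacy by Chebotarev–Brauer–Nesbitt
(`FramedGaloisRep.nonempty_equiv_of_hasFrobCharpolyAt_eventually chebotarev_artinRep_holds`,
`FramedRep.exists_eq_conj_of_equiv`); the non-vacuity conjunct is N.  Axioms: propext, Classical.choice,
Quot.sound.

References: K. Buzzard, T. Gee, LMS LNS 414 (2014), Conj. 3.2.1–3.2.2 [BuzzardGeeLMS2014]; J.-M. Fontaine,
B. Mazur (1995), Conj. 1 [FontaineMazurGeometric1995]; R. Taylor, Ann. Fac. Sci. Toulouse 13 (2004), Conj. 7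
[TaylorGaloisRepresentations2004]; J. Arthur, L. Clozel, Ann. Math. Stud. 120, Ch. 3 §2 (2.2)–(2.3)
[ArthurClozelAMS120]; F. Calegari, T. Gee, Ann. Inst. Fourier 63 (2013) §1.1 [CalegariGee2013]; P. Deligne,
J.-P. Serre, ASENS 7 (1974), Lemme 3.2 [DeligneSerreASENS1974]; M. Harris, R. Taylor, Ann. Math. Stud. 151 (2001),
Thm. A [HarrisTaylorAMS2001].
-/

noncomputable section

set_option linter.dupNamespace false -- project-wide option; `Summit.Langlands.Langlands` is the mandated namespace

open scoped NumberField Classical Polynomial Topology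
open Filter IsDedekindDomain
open Literature.NumberTheory.Automorphic Literature.NumberTheory.GaloisRepresentations
open Summit.Langlands
open Summit.Langlands.Langlands.Theorems.ReciprocityUpToIrreducibility

namespace Summit.Langlands.Langlands.Theorems.MirrorPairReflectionSectorComplement

/-- **`MirrorPairReflection.SectorComplement` from its seven typed leaves** (BC2 REDIRECT assembly, structural
form: `CanonicalReciprocityData → WeakExistence → WeakAutomorphyOffSector → SectorAutomorphyOfClassification →
PairCompatibilityAllData → PairLBoundaryJS → PairLPoleJS → SectorComplement`, every decl unfolded to its text).
Given the route target `X`, weak automorphy is rebuilt from its off/on-sector halves; the isobaric bootstrap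
(geometric constituents + de Rham heredity + Jacquet–Shalika rigidity) makes every pinned-geometric
a.e.-compatible avatar of a cuspidal `π` irreducible; then, for every reciprocity datum `𝓡`, (B) is weak
automorphy + pair compatibility and (A) is weak existence + bootstrap + pair compatibility + Chebotarev–
Brauer–Nesbitt uniqueness; the non-vacuity conjunct is the first leaf.
[cite: BuzzardGeeLMS2014, Conj. 3.2.1 and Conj. 3.2.2] [cite: ArthurClozelAMS120, Ch. 3 §2 (2.2)–(2.3)]
[cite: CalegariGee2013, §1.1] [cite: DeligneSerreASENS1974, Lemme 3.2] [cite: HarrisTaylorAMS2001, Thm. A] -/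
theorem sectorComplement_of_leaves
    (hN : ∀ (F : Type) [Field F] [NumberField F], Nonempty (Summit.Langlands.ReciprocityData F))
    (hW : ∀ (K : Type) [Field K] [NumberField K] (n : ℕ) (hcpt : Literature.NumberTheory.Automorphic.isCompact_glFiniteIntegralLevel n K), 0 < n → ∀ π : Literature.NumberTheory.Automorphic.CuspidalAutomorphicRepData n K hcpt, π.1.IsLAlgebraic → ∀ (ℓ : ℕ) [Fact ℓ.Prime] (ι : PadicAlgCl ℓ ≃+* ℂ), ∃ ρ : Literature.NumberTheory.GaloisRepresentations.FramedGaloisRep K (PadicAlgCl ℓ) n, ((∀ᶠ v : IsDedekindDomain.HeightOneSpectrum (NumberField.RingOfIntegers K) in cofinite, ρ.IsUnramifiedAt v) ∧ ∀ (v : IsDedekindDomain.HeightOneSpectrum (NumberField.RingOfIntegers K)) (hv : ((ℓ : ℕ) : NumberField.RingOfIntegers K) ∈ v.asIdeal), (Literature.NumberTheory.PAdicHodge.fontainePstAdicCompletion v ℓ hv).IsDeRhamFramed (ρ.toLocal v)) ∧ ∀ᶠ v : IsDedekindDomain.HeightOneSpectrum (NumberField.RingOfIntegers K) in cofinite, SatakeFrobCompatibleAt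 ι π.1 ρ v)
    (hOff : ∀ (K : Type) [Field K] [NumberField K] (n : ℕ) (hcpt : Literature.NumberTheory.Automorphic.isCompact_glFiniteIntegralLevel n K), 0 < n → ∀ (ℓ : ℕ) [Fact ℓ.Prime] (ι : PadicAlgCl ℓ ≃+* ℂ) (ρ : Literature.NumberTheory.GaloisRepresentations.FramedGaloisRep K (PadicAlgCl ℓ) n), ρ.toGaloisRep.IsIrreducible → ((∀ᶠ v : IsDedekindDomain.HeightOneSpectrum (NumberField.RingOfIntegers K) in cofinite, ρ.IsUnramifiedAt v) ∧ ∀ (v : IsDedekindDomain.HeightOneSpectrum (NumberField.RingOfIntegers K)) (hv : ((ℓ : ℕ) : NumberField.RingOfIntegers K) ∈ v.asIdeal), (Literature.NumberTheory.PAdicHodge.fontainePstAdicCompletion v ℓ hv).IsDeRhamFramed (ρ.toLocal v)) → ¬ (Module.finrank ℚ K = 1 ∧ n = 2 ∧ ℓ ≠ 2 ∧ (∀ v : IsDedekindDomain.HeightOneSpectrum (NumberField.RingOfIntegers K), ((ℓ : ℕ) : NumberField.RingOfIntegers K) ∉ v.asIdeal → ρ.IsUnramifiedAt v) ∧ ∃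 a b : ℕ, Even (a + b) ∧ ∀ g : Field.absoluteGaloisGroup K, ‖Literature.NumberTheory.GaloisRepresentations.FramedRep.trace ρ g - ((algebraMap ℚ_[ℓ] (PadicAlgCl ℓ) (((Literature.NumberTheory.GaloisRepresentations.GaloisRep.cyclotomicCharacter K ℓ g : ℤ_[ℓ]ˣ) : ℤ_[ℓ]) : ℚ_[ℓ])) ^ a + (algebraMap ℚ_[ℓ] (PadicAlgCl ℓ) (((Literature.NumberTheory.GaloisRepresentations.GaloisRep.cyclotomicCharacter K ℓ g : ℤ_[ℓ]ˣ) : ℤ_[ℓ]) : ℚ_[ℓ])) ^ b)‖ < 1) → ∃ π : Literature.NumberTheory.Automorphic.CuspidalAutomorphicRepData n K hcpt, π.1.IsLAlgebraic ∧ ∀ᶠ v : IsDedekindDomain.HeightOneSpectrum (NumberField.RingOfIntegers K) in cofinite, SatakeFrobCompatibleAt ι π.1 ρ v)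
    (hOn : (∀ (p : ℕ) [Fact p.Prime], p ≠ 2 → ∀ (σ : Literature.NumberTheory.GaloisRepresentations.FramedGaloisRep ℚ (PadicAlgCl p) 2) (a b : ℕ), (∀ v : IsDedekindDomain.HeightOneSpectrum (NumberField.RingOfIntegers ℚ), ((p : ℕ) : NumberField.RingOfIntegers ℚ) ∉ v.asIdeal → σ.IsUnramifiedAt v) → Even (a + b) → (∀ g : Field.absoluteGaloisGroup ℚ, ‖Literature.NumberTheory.GaloisRepresentations.FramedRep.trace σ g - ((algebraMap ℚ_[p] (PadicAlgCl p) (((Literature.NumberTheory.GaloisRepresentations.GaloisRep.cyclotomicCharacter ℚ p g : ℤ_[p]ˣ) : ℤ_[p]) : ℚ_[p])) ^ a + (algebraMap ℚ_[p] (PadicAlgCl p) (((Literature.NumberTheory.GaloisRepresentations.GaloisRep.cyclotomicCharacter ℚ p g : ℤ_[p]ˣ) : ℤ_[p]) : ℚ_[p])) ^ b)‖ < 1) → Literature.NumberTheory.GaloisRepresentations.FramedRep.IsIrreducible σ → p % 4 = 1 ∧ 2 * (((b : ℤ) - a) % ((p : ℤ) - 1)).toNat = p - 1 ∧ ((p :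 ℤ) ∣ (bernoulli ((p - 1) / 2)).num) ∧ (∃ (P : Matrix.GeneralLinearGroup (Fin 2) (PadicAlgCl p)) (r : AlgebraicClosure ℚ), r ^ 2 = (p : AlgebraicClosure ℚ) ∧ ∀ g : Field.absoluteGaloisGroup ℚ, g • r = r → ((P * σ g * P⁻¹ : Matrix.GeneralLinearGroup (Fin 2) (PadicAlgCl p)) : Matrix (Fin 2) (Fin 2) (PadicAlgCl p)) 0 1 = 0 ∧ ((P * σ g * P⁻¹ : Matrix.GeneralLinearGroup (Fin 2) (PadicAlgCl p)) : Matrix (Fin 2) (Fin 2) (PadicAlgCl p)) 1 0 = 0)) → ∀ (K : Type) [Field K] [NumberField K], Module.finrank ℚ K = 1 → ∀ (hcpt : Literature.NumberTheory.Automorphic.isCompact_glFiniteIntegralLevel 2 K) (ℓ : ℕ) [Fact ℓ.Prime], ℓ ≠ 2 → ∀ (ι : PadicAlgCl ℓ ≃+* ℂ) (ρ : Literature.NumberTheory.GaloisRepresentations.FramedGaloisRep K (PadicAlgCl ℓ) 2), ρ.toGaloisRep.IsIrreducible → ((∀ᶠ v : IsDedekindDomain.HeightOneSpectrum (NumberField.RingOfIntegers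 K) in cofinite, ρ.IsUnramifiedAt v) ∧ ∀ (v : IsDedekindDomain.HeightOneSpectrum (NumberField.RingOfIntegers K)) (hv : ((ℓ : ℕ) : NumberField.RingOfIntegers K) ∈ v.asIdeal), (Literature.NumberTheory.PAdicHodge.fontainePstAdicCompletion v ℓ hv).IsDeRhamFramed (ρ.toLocal v)) → (∀ v : IsDedekindDomain.HeightOneSpectrum (NumberField.RingOfIntegers K), ((ℓ : ℕ) : NumberField.RingOfIntegers K) ∉ v.asIdeal → ρ.IsUnramifiedAt v) → ∀ (a b : ℕ), Even (a + b) → (∀ g : Field.absoluteGaloisGroup K, ‖Literature.NumberTheory.GaloisRepresentations.FramedRep.trace ρ g - ((algebraMap ℚ_[ℓ] (PadicAlgCl ℓ) (((Literature.NumberTheory.GaloisRepresentations.GaloisRep.cyclotomicCharacter K ℓ g : ℤ_[ℓ]ˣ) : ℤ_[ℓ]) : ℚ_[ℓ])) ^ a + (algebraMap ℚ_[ℓ] (PadicAlgCl ℓ) (((Literature.NumberTheory.GaloisRepresentations.GaloisRep.cyclotomicCharacter K ℓ g : ℤ_[ℓ]ˣ) : ℤ_[ℓ]) : ℚ_[ℓ]))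 ^ b)‖ < 1) → ∃ π : Literature.NumberTheory.Automorphic.CuspidalAutomorphicRepData 2 K hcpt, π.1.IsLAlgebraic ∧ ∀ᶠ v : IsDedekindDomain.HeightOneSpectrum (NumberField.RingOfIntegers K) in cofinite, SatakeFrobCompatibleAt ι π.1 ρ v)
    (hL : ∀ (K : Type) [Field K] [NumberField K] (Rec : ReciprocityData K) (n : ℕ) (hcpt : Literature.NumberTheory.Automorphic.isCompact_glFiniteIntegralLevel n K), 0 < n → ∀ (π : Literature.NumberTheory.Automorphic.CuspidalAutomorphicRepData n K hcpt), π.1.IsLAlgebraic → ∀ (ℓ : ℕ) [Fact ℓ.Prime] (ι : PadicAlgCl ℓ ≃+* ℂ) (ρ : Literature.NumberTheory.GaloisRepresentations.FramedGaloisRep K (PadicAlgCl ℓ) n), ρ.toGaloisRep.IsIrreducible → ((∀ᶠ v : IsDedekindDomain.HeightOneSpectrum (NumberField.RingOfIntegers K) in cofinite, ρ.IsUnramifiedAt v) ∧ ∀ (v : IsDedekindDomain.HeightOneSpectrum (NumberField.RingOfIntegers K)) (hv : ((ℓ : ℕ) : NumberField.RingOfIntegers K) ∈ v.asIdeal), (Literature.NumberTheory.PAdicHodge.fontainePstAdicCompletion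 v ℓ hv).IsDeRhamFramed (ρ.toLocal v)) → (∀ᶠ v : IsDedekindDomain.HeightOneSpectrum (NumberField.RingOfIntegers K) in cofinite, SatakeFrobCompatibleAt ι π.1 ρ v) → ∀ v : IsDedekindDomain.HeightOneSpectrum (NumberField.RingOfIntegers K), LocalGlobalCompatibleAt Rec ι π.1 ρ v)
    (hJSb : ∀ (n m : ℕ) (F : Type) [Field F] [NumberField F] (hF : _) (hF' : _), 0 < n → 0 < m → ∀ (π : Literature.NumberTheory.Automorphic.CuspidalAutomorphicRepData n F hF) (π' : Literature.NumberTheory.Automorphic.CuspidalAutomorphicRepData m F hF'), ∃ S₀ : Set (IsDedekindDomain.HeightOneSpectrum (NumberField.RingOfIntegers F)), S₀.Finite ∧ ∀ {S : Set (IsDedekindDomain.HeightOneSpectrum (NumberField.RingOfIntegers F))}, S.Finite → S₀ ⊆ S → ∀ {α β : IsDedekindDomain.HeightOneSpectrum (NumberField.RingOfIntegers F) → Multiset ℂ}, (∀ w ∉ S, π.1.HasSatakeParamAt w (α w)) → (∀ w ∉ S, π'.1.HasSatakeParamAt w (β w)) → (∀ w ∉ S, ‖(α w).prod‖ = 1)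 → (∀ w ∉ S, ‖(β w).prod‖ = 1) → ∀ {s₀ : ℂ}, s₀.re = 1 → ¬ (n = m ∧ ∀ᶠ w in cofinite, (α w).map ((((w.residueCard : ℂ) ^ (1 - s₀))) * ·) = (β w).map (·⁻¹)) → ∃ c : ℂ, c ≠ 0 ∧ Tendsto (fun s : ℂ => ∏' w : {w : IsDedekindDomain.HeightOneSpectrum (NumberField.RingOfIntegers F) // w ∉ S}, ((Literature.NumberTheory.Automorphic.satakePairPolynomial (α w.1) (β w.1)).eval ((w.1.residueCard : ℂ) ^ (-s)))⁻¹) (𝓝[{s : ℂ | 1 < s.re}] s₀) (𝓝 c))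
    (hJSp : ∀ (n : ℕ) (F : Type) [Field F] [NumberField F] (hF : Literature.NumberTheory.Automorphic.isCompact_glFiniteIntegralLevel n F), 0 < n → ∀ (π π' : Literature.NumberTheory.Automorphic.CuspidalAutomorphicRepData n F hF), ∃ S₀ : Set (IsDedekindDomain.HeightOneSpectrum (NumberField.RingOfIntegers F)), S₀.Finite ∧ ∀ {S : Set (IsDedekindDomain.HeightOneSpectrum (NumberField.RingOfIntegers F))}, S.Finite → S₀ ⊆ S → ∀ {α β : IsDedekindDomain.HeightOneSpectrum (NumberField.RingOfIntegers F) → Multiset ℂ}, (∀ w ∉ S, π.1.HasSatakeParamAt w (α w)) → (∀ w ∉ S, π'.1.HasSatakeParamAt w (β w)) → (∀ w ∉ S, ‖(α w).prod‖ = 1) → (∀ w ∉ S, ‖(β w).prod‖ = 1) → ∀ {s₀ : ℂ}, s₀.re = 1 → (∀ᶠ w in cofinite, (α w).map ((((w.residueCard : ℂ) ^ (1 - s₀))) * ·) = (β w).map (·⁻¹)) → ∃ c : ℂ, c ≠ 0 ∧ Tendsto (fun s : ℂ => (s - s₀) * ∏' w : {w : IsDedekindDomain.HeightOneSpectrum (NumberField.RingOfIntegers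 F) // w ∉ S}, ((Literature.NumberTheory.Automorphic.satakePairPolynomial (α w.1) (β w.1)).eval ((w.1.residueCard : ℂ) ^ (-s)))⁻¹) (𝓝[{s : ℂ | 1 < s.re}] s₀) (𝓝 c)) :
    (∀ (p : ℕ) [Fact p.Prime], p ≠ 2 → ∀ (σ : Literature.NumberTheory.GaloisRepresentations.FramedGaloisRep ℚ (PadicAlgCl p) 2) (a b : ℕ), (∀ v : IsDedekindDomain.HeightOneSpectrum (NumberField.RingOfIntegers ℚ), ((p : ℕ) : NumberField.RingOfIntegers ℚ) ∉ v.asIdeal → σ.IsUnramifiedAt v) → Even (a + b) → (∀ g : Field.absoluteGaloisGroup ℚ, ‖Literature.NumberTheory.GaloisRepresentations.FramedRep.trace σ g - ((algebraMap ℚ_[p] (PadicAlgCl p) (((Literature.NumberTheory.GaloisRepresentations.GaloisRep.cyclotomicCharacter ℚ p g : ℤ_[p]ˣ) : ℤ_[p]) : ℚ_[p])) ^ a + (algebraMap ℚ_[p] (PadicAlgCl p) (((Literature.NumberTheory.GaloisRepresentations.GaloisRep.cyclotomicCharacter ℚ p g : ℤ_[p]ˣ) : ℤ_[p]) : ℚ_[p]))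 ^ b)‖ < 1) → Literature.NumberTheory.GaloisRepresentations.FramedRep.IsIrreducible σ → p % 4 = 1 ∧ 2 * (((b : ℤ) - a) % ((p : ℤ) - 1)).toNat = p - 1 ∧ ((p : ℤ) ∣ (bernoulli ((p - 1) / 2)).num) ∧ (∃ (P : Matrix.GeneralLinearGroup (Fin 2) (PadicAlgCl p)) (r : AlgebraicClosure ℚ), r ^ 2 = (p : AlgebraicClosure ℚ) ∧ ∀ g : Field.absoluteGaloisGroup ℚ, g • r = r → ((P * σ g * P⁻¹ : Matrix.GeneralLinearGroup (Fin 2) (PadicAlgCl p)) : Matrix (Fin 2) (Fin 2) (PadicAlgCl p)) 0 1 = 0 ∧ ((P * σ g * P⁻¹ : Matrix.GeneralLinearGroup (Fin 2) (PadicAlgCl p)) : Matrix (Fin 2) (Fin 2) (PadicAlgCl p)) 1 0 = 0)) → _root_.Langlands := by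
  intro hX
  -- the two Jacquet–Shalika texts ARE the Literature named facts (delta/eta)
  have h22 : JacquetShalika1981_partialPairL_boundary_repData := hJSb
  have h23 : JacquetShalika1981_partialPairL_pole_repData := hJSp
  -- B_w (Fontaine–Mazur–Langlands, a.e. form) from its two halves: X's sector is discharged by X
  have hB : ∀ (K : Type) [Field K] [NumberField K] (n : ℕ) (hcpt : isCompact_glFiniteIntegralLevel n K), 0 < n →
      ∀ (ℓ : ℕ) [Fact ℓ.Prime] (ι : PadicAlgCl ℓ ≃+* ℂ) (ρ : FramedGaloisRep K (PadicAlgCl ℓ) n),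
        ρ.toGaloisRep.IsIrreducible →
        ((∀ᶠ v : HeightOneSpectrum (𝓞 K) in cofinite, ρ.IsUnramifiedAt v) ∧
          ∀ (v : HeightOneSpectrum (𝓞 K)) (hv : ((ℓ : ℕ) : 𝓞 K) ∈ v.asIdeal),
            (Literature.NumberTheory.PAdicHodge.fontainePstAdicCompletion v ℓ hv).IsDeRhamFramed (ρ.toLocal v)) →
        ∃ π : CuspidalAutomorphicRepData n K hcpt, π.1.IsLAlgebraic ∧
          ∀ᶠ v : HeightOneSpectrum (𝓞 K) in cofinite, SatakeFrobCompatibleAt ι π.1 ρ v := by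
    intro K _ _ n hcpt hn ℓ _ ι ρ hirr hgeo
    by_cases hs : (Module.finrank ℚ K = 1 ∧ n = 2 ∧ ℓ ≠ 2 ∧ (∀ v : IsDedekindDomain.HeightOneSpectrum (NumberField.RingOfIntegers K), ((ℓ : ℕ) : NumberField.RingOfIntegers K) ∉ v.asIdeal → ρ.IsUnramifiedAt v) ∧ ∃ a b : ℕ, Even (a + b) ∧ ∀ g : Field.absoluteGaloisGroup K, ‖Literature.NumberTheory.GaloisRepresentations.FramedRep.trace ρ g - ((algebraMap ℚ_[ℓ] (PadicAlgCl ℓ) (((Literature.NumberTheory.GaloisRepresentations.GaloisRep.cyclotomicCharacter K ℓ g : ℤ_[ℓ]ˣ) : ℤ_[ℓ]) : ℚ_[ℓ])) ^ a + (algebraMap ℚ_[ℓ] (PadicAlgCl ℓ) (((Literature.NumberTheory.GaloisRepresentations.GaloisRep.cyclotomicCharacter K ℓ g : ℤ_[ℓ]ˣ) : ℤ_[ℓ]) : ℚ_[ℓ])) ^ b)‖ < 1)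
    · obtain ⟨hK, rfl, hℓ, hur, a, b, hab, htr⟩ := hs
      exact hOn hX K hK hcpt ℓ hℓ ι ρ hirr hgeo hur a b hab htr
    · exact hOff K n hcpt hn ℓ ι ρ hirr hgeo hs
  -- the isobaric bootstrap, run with B_w: a pinned-geometric avatar of a cuspidal `π` is irreducible
  have irr : ∀ (K : Type) [Field K] [NumberField K] (n : ℕ) (hcpt : isCompact_glFiniteIntegralLevel n K)
      (_ : 0 < n) (π : CuspidalAutomorphicRepData n K hcpt) (ℓ : ℕ) [Fact ℓ.Prime]
      (ι : PadicAlgCl ℓ ≃+* ℂ) (ρ : FramedGaloisRep K (PadicAlgCl ℓ) n),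
      ((∀ᶠ v : HeightOneSpectrum (𝓞 K) in cofinite, ρ.IsUnramifiedAt v) ∧
        ∀ (v : HeightOneSpectrum (𝓞 K)) (hv : ((ℓ : ℕ) : 𝓞 K) ∈ v.asIdeal),
          (Literature.NumberTheory.PAdicHodge.fontainePstAdicCompletion v ℓ hv).IsDeRhamFramed
            (ρ.toLocal v)) →
      (∀ᶠ v : HeightOneSpectrum (𝓞 K) in cofinite, SatakeFrobCompatibleAt ι π.1 ρ v) →
        ρ.toGaloisRep.IsIrreducible := by
    intro K _ _ n hcpt hn π ℓ _ ι ρ hgeo hρ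
    obtain ⟨k, m, r, hr, hchar, -, hone⟩ :=
      stub_geometricConstituents stub_deRhamBlocks K ℓ n ρ hn hgeo
    by_cases hk1 : k = 1
    · exact hone hk1
    have hk0 : k ≠ 0 := by
      rintro rfl
      have h1 := hchar 1
      simp only [Finset.univ_eq_empty, Finset.prod_empty] at h1
      have hdeg : (FramedRep.charpoly ρ 1).natDegree = n := by
        simp [FramedRep.charpoly, Matrix.charpoly_natDegree_eq_dim]
      rw [h1, Polynomial.natDegree_one] at hdeg
      omega
    have hk2 : 2 ≤ k := by omega
    have hσ : ∀ i, ∃ σ : CuspidalAutomorphicRepData (m i) K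
        (isCompact_glFiniteIntegralLevel_holds (m i) K),
        ∀ᶠ v : HeightOneSpectrum (𝓞 K) in cofinite, SatakeFrobCompatibleAt ι σ.1 (r i) v := by
      intro i
      obtain ⟨σ, -, hcorr⟩ := hB K (m i) (isCompact_glFiniteIntegralLevel_holds (m i) K) (hr i).1 ℓ ι
        (r i) (hr i).2.1 (hr i).2.2
      exact ⟨σ, hcorr⟩
    choose σ hσc using hσ
    refine (stub_isobaricRigidity h22 h23 K n hcpt π k m
      (fun i => isCompact_glFiniteIntegralLevel_holds (m i) K) σ hn hk2 (fun i => (hr i).1) ?_).elim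
    have hall : ∀ᶠ v : HeightOneSpectrum (𝓞 K) in cofinite,
        ∀ i, SatakeFrobCompatibleAt ι (σ i).1 (r i) v :=
      Filter.eventually_all.mpr hσc
    filter_upwards [hρ, hall] with v hv hvi
    intro α hα
    obtain ⟨α₀, hα₀, -, hcp⟩ := hv
    obtain rfl : α = α₀ := AutomorphicRepData.hasSatakeParamAt_unique_holds π.1 hα hα₀
    choose β hβ _hurβ hcpβ using hvi
    refine ⟨β, hβ, ?_⟩
    have hprod : ρ.HasFrobCharpolyAt v (∏ i, arithFrobPolyOfSatake ι v.residueCard 1 (β i)) := by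
      intro 𝔓 h𝔓 τ hτ
      rw [hchar τ]
      exact Finset.prod_congr rfl fun i _ => hcpβ i 𝔓 h𝔓 τ hτ
    rw [← Summit.Langlands.Langlands.Theorems.IrreducibleOffSector.arithFrobPolyOfSatake_sum] at hprod
    have heq : arithFrobPolyOfSatake ι v.residueCard 1 α =
        arithFrobPolyOfSatake ι v.residueCard 1 (∑ i, β i) :=
      GaloisRep.HasFrobCharpolyAt.unique_holds
        ((FramedGaloisRep.hasFrobCharpolyAt_toGaloisRep_iff v _ ρ).mpr hcp)
        ((FramedGaloisRep.hasFrobCharpolyAt_toGaloisRep_iff v _ ρ).mpr hprod)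
    exact arithFrobPolyOfSatake_one_injective ι _ heq
  -- the revised summit: non-vacuity conjunct from N, then (A) ∧ (B) for EVERY reciprocity datum 𝓡
  intro F _ _
  refine ⟨hN F, fun 𝓡 n hn hcpt => ⟨?_, ?_⟩⟩
  · -- (A): weak existence + bootstrap + pair compatibility; uniqueness by Chebotarev–Brauer–Nesbitt
    intro π hL' ℓ _ ι
    obtain ⟨ρ, hgeo, hρ⟩ := hW F n hcpt hn π hL' ℓ ι
    have hirr : ρ.toGaloisRep.IsIrreducible := irr F n hcpt hn π ℓ ι ρ hgeo hρ
    have hcorr : Corresponds 𝓡 ι π.1 ρ := ⟨hρ, hL F 𝓡 n hcpt hn π hL' ℓ ι ρ hirr hgeo hρ⟩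
    refine ⟨ρ, hirr, hgeo, hcorr, fun ρ' hcorr' => ?_⟩
    -- uniqueness up to conjugacy: the corresponding `ρ'` is irreducible too — by the landed bootstrap
    -- `IrreducibleOffSector.isIrreducible_of_reciprocityUpToIrreducibility` run with the datum `𝓡`
    -- (reciprocity up to irreducibility for `𝓡` = W + bootstrap + L and B_w + L) —, hence both are
    -- semisimple with equal Frobenius polynomials a.e. (Flath: unique Satake parameters), so they are
    -- equivalent (Chebotarev + Brauer–Nesbitt) and conjugate.
    have hRec : ∀ n : ℕ, 0 < n → ∀ hcpt : isCompact_glFiniteIntegralLevel n F,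
        (∀ π : CuspidalAutomorphicRepData n F hcpt, π.1.IsLAlgebraic →
          ∀ (ℓ : ℕ) [Fact ℓ.Prime] (ι : PadicAlgCl ℓ ≃+* ℂ),
            ∃ ρ : FramedGaloisRep F (PadicAlgCl ℓ) n, IsGeometricFramed 𝓡 ρ ∧ Corresponds 𝓡 ι π.1 ρ) ∧
        GaloisToAutomorphic n 𝓡 hcpt := by
      intro n' hn' hcpt'
      refine ⟨fun π' hL'' ℓ' _ ι' => ?_, fun ℓ' _ ι' ρ' hirr' hgeo' => ?_⟩
      · obtain ⟨ρ', hgeo', hρ'⟩ := hW F n' hcpt' hn' π' hL'' ℓ' ι'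
        have hirr' : ρ'.toGaloisRep.IsIrreducible := irr F n' hcpt' hn' π' ℓ' ι' ρ' hgeo' hρ'
        exact ⟨ρ', hgeo', hρ', hL F 𝓡 n' hcpt' hn' π' hL'' ℓ' ι' ρ' hirr' hgeo' hρ'⟩
      · obtain ⟨π', hL'', hρ'⟩ := hB F n' hcpt' hn' ℓ' ι' ρ' hirr' hgeo'
        exact ⟨π', hL'', hρ', hL F 𝓡 n' hcpt' hn' π' hL'' ℓ' ι' ρ' hirr' hgeo' hρ'⟩
    have h2 : ρ'.toGaloisRep.IsIrreducible :=
      Summit.Langlands.Langlands.Theorems.IrreducibleOffSector.isIrreducible_of_reciprocityUpToIrreducibility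
        h22 h23 hRec hcpt hn π hL' ι ρ' hcorr'.1
    have hs1 : ρ.toGaloisRep.IsSemisimple := by
      haveI := hirr
      change ComplementedLattice _
      infer_instance
    have hs2 : ρ'.toGaloisRep.IsSemisimple := by
      haveI := h2
      change ComplementedLattice _
      infer_instance
    have hev : ∀ᶠ v : HeightOneSpectrum (𝓞 F) in cofinite,
        ρ.IsUnramifiedAt v ∧ ρ'.IsUnramifiedAt v ∧
          ∃ P : Polynomial (PadicAlgCl ℓ), ρ.HasFrobCharpolyAt v P ∧ ρ'.HasFrobCharpolyAt v P := by
      filter_upwards [hcorr.1, hcorr'.1] with v hv hv'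
      obtain ⟨α, hα, hur, hcp⟩ := hv
      obtain ⟨α', hα', hur', hcp'⟩ := hv'
      obtain rfl : α = α' := AutomorphicRepData.hasSatakeParamAt_unique_holds π.1 hα hα'
      exact ⟨hur, hur', _, hcp, hcp'⟩
    obtain ⟨e⟩ := FramedGaloisRep.nonempty_equiv_of_hasFrobCharpolyAt_eventually
      chebotarev_artinRep_holds ρ ρ' hs1 hs2 hev
    obtain ⟨P, hP⟩ := FramedRep.exists_eq_conj_of_equiv ρ ρ' e
    exact ⟨P, hP.symm⟩
  · -- (B): weak automorphy + pair compatibility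
    intro ℓ _ ι ρ hirr hgeo
    obtain ⟨π, hL', hρ⟩ := hB F n hcpt hn ℓ ι ρ hirr hgeo
    exact ⟨π, hL', hρ, hL F 𝓡 n hcpt hn π hL' ℓ ι ρ hirr hgeo hρ⟩

end Summit.Langlands.Langlands.Theorems.MirrorPairReflectionSectorComplement

end
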